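import Mathlib
import HarnessLib
import Summits.NavierStokesRegularity.NavierStokesRegularity.Theses.HalfSpaceWindowDoor
import Literature.Analysis.FluidPDE.AxisymmetricEuler
import Literature.Analysis.FluidPDE.VectorCalculus

/-!
# Route `HalfSpaceWindowDoor`, crux `CirculationCarryingRigidity` (stmt-NavierStokesRegularity-25311) — the typed
# substrate of the line `birth` (skeleton of record `CirculationCarryingRigidity_birth_v2_g3.lean`, sha b0f8cfc077185310)

The registered stub signatures of the crux skeleton (planner of record ns-idea-6 g3, KEY-NS #70) are the NAMES
`RotationCovariance`, `StubWindowedFluxDecay`, `StubLayerExclusion`, built on the auxiliary objects `e3`, `planePt`,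
`gaussWin`, `HemisphereLiouvilleE3`, `WindowedFluxDecay`.  This file fixes that vocabulary ONCE in the tree, with the
texts of the skeleton VERBATIM, so that the stub theorems (`stub_rotate : RotationCovariance`, …) can be landed BY NAME
in `Theorems/HalfSpaceWindowDoorCirculationCarryingRigidity*.lean` files instead of re-declaring the objects in proof
files (CONVENTIONS: definitions a line posits live in a reviewed `…Defs` file, never inside a proof file).

* `e3 = EuclideanSpace.single 2 1` — the fixed direction after rotation;
* `planePt c y = (y₀, y₁, c)` — the horizontal plane at height `c`, parametrised by `ℝ²`;
* `gaussWin L a y = exp(−‖y−a‖²/(4L²))/(4πL²)` — the unit-mass in-plane Gaussian window of width `L` centred at `a`;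
* `HemisphereLiouvilleE3` — the crux specialised to `e₃` in Liouville form (closed-hemisphere Type-I ancient
  Oseen-mild profiles have `⟪curl v, e₃⟫ ≡ 0`);
* `WindowedFluxDecay C v` — the Gaussian-windowed `e₃`-flux through every horizontal plane is `≤ K/(L√(−s))`;
* `StubWindowedFluxDecay`, `StubLayerExclusion`, `RotationCovariance` — the three registered stub statements.

Seat ns-hsw-p1 (LEAD of 25311, cell pub-ns-dss, director-ns g12 req135).  WHAT THIS IS NOT: not a statement about
Navier–Stokes regularity (Clay A); the door statements are regularity CRITERIA about HYPOTHETICAL blow-up profiles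
(KNSS ancient mild solutions); vocabulary only — nothing is proved here and no item is closed by this file.
-/

noncomputable section

-- the summit and its single sub-problem share the name (CONVENTIONS §1), as in every Theorems file
set_option linter.dupNamespace false

namespace Summit.NavierStokesRegularity.NavierStokesRegularity.Theorems.HalfSpaceWindowDoorCirculationCarryingRigidityDefs

open scoped BigOperators Topology MeasureTheory InnerProductSpace
open Filter Set Function MeasureTheory
open Summit.NavierStokesRegularity.NavierStokesRegularity.Theses.HalfSpaceWindowDoor

/-- The fixed direction after rotation: `e₃ = (0, 0, 1)` (skeleton text verbatim). -/
def e3 : EuclideanSpace ℝ (Fin 3) := EuclideanSpace.single (2 : Fin 3) (1 : ℝ)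

/-- The horizontal plane at height `c`, parametrised by `ℝ²`: `planePt c y = (y₀, y₁, c)` (skeleton text verbatim). -/
def planePt (c : ℝ) (y : EuclideanSpace ℝ (Fin 2)) : EuclideanSpace ℝ (Fin 3) := WithLp.toLp 2 ![y 0, y 1, c]

/-- The in-plane Gaussian window of width `L` centred at `a` (unit mass for `L ≠ 0`):
`gaussWin L a y = exp(−‖y − a‖² / (4L²)) / (4πL²)` (skeleton text verbatim). -/
def gaussWin (L : ℝ) (a y : EuclideanSpace ℝ (Fin 2)) : ℝ :=
  Real.exp (-(‖y - a‖ ^ 2) / (4 * L ^ 2)) / (4 * Real.pi * L ^ 2)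

/-- The crux specialised to the direction `e₃` and strengthened to a Liouville statement: a closed-hemisphere
Type-I ancient Oseen-mild profile (Type-I time rate, continuous on the open lower slab, unit-viscosity Oseen–Duhamel
identity between negative times, divergence-free slices, `⟪curl v(s), e₃⟫ ≥ 0` everywhere) is poloidal:
`⟪curl v(s), e₃⟫ ≡ 0` (skeleton text verbatim). -/
def HemisphereLiouvilleE3 : Prop :=
  ∀ (C : ℝ) (v : ℝ → EuclideanSpace ℝ (Fin 3) → EuclideanSpace ℝ (Fin 3)), Literature.Analysis.FluidPDE.HasTypeITimeDecay C v → ContinuousOn (Function.uncurry v) (Set.Iio (0 : ℝ) ×ˢ Set.univ) → (∀ s t : ℝ, s < t → t < 0 → ∀ x, v t x = Literature.Analysis.UnboundedOperators.heatExtension (v s) (t - s) x - Literature.Analysis.FluidPDE.oseenDuhamel 1 s v v t x) → (∀ t < 0, Literature.Analysis.FluidPDE.VectorCalculus.IsDivFree (v t)) → (∀ s < 0, ∀ y, 0 ≤ ⟪Literature.Analysis.FluidPDE.curl (v s) y, e3⟫_ℝ) → ∀ s < 0, ∀ y, ⟪Literature.Analysis.FluidPDE.curl (v s) y, e3⟫_ℝ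 = 0

/-- WINDOWED directional flux decay: for every in-plane Gaussian window of width `L > 0`, every height `c`, centre `a`
and time `s < 0`, `∫ ⟪curl v(s), e₃⟫ · g_(L,a) ≤ K / (L √(−s))` over the plane `{x₃ = c}` (as a lower Lebesgue
integral of the positive part; one constant `K ≥ 0` for the profile).  The Type-I constant `C` is carried as an
(unused) parameter, as in the skeleton (text verbatim). -/
def WindowedFluxDecay (_C : ℝ) (v : ℝ → EuclideanSpace ℝ (Fin 3) → EuclideanSpace ℝ (Fin 3)) : Prop :=
  ∃ K : ℝ, 0 ≤ K ∧ ∀ s < 0, ∀ L : ℝ, 0 < L → ∀ (c : ℝ) (a : EuclideanSpace ℝ (Fin 2)),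
    ∫⁻ y : EuclideanSpace ℝ (Fin 2), ENNReal.ofReal (⟪Literature.Analysis.FluidPDE.curl (v s) (planePt c y), e3⟫_ℝ * gaussWin L a y)
      ≤ ENNReal.ofReal (K / (L * Real.sqrt (-s)))

/-- Statement of the stub `stub_windowedFluxDecay` (registered signature `StubWindowedFluxDecay`): every
closed-hemisphere profile of the route's Type-I class has the windowed flux decay (skeleton text verbatim). -/
def StubWindowedFluxDecay : Prop :=
  ∀ (C : ℝ) (v : ℝ → EuclideanSpace ℝ (Fin 3) → EuclideanSpace ℝ (Fin 3)), Literature.Analysis.FluidPDE.HasTypeITimeDecay C v → ContinuousOn (Function.uncurry v) (Set.Iio (0 : ℝ) ×ˢ Set.univ) → (∀ s t : ℝ, s < t → t < 0 → ∀ x, v t x = Literature.Analysis.UnboundedOperators.heatExtension (v s) (t - s) x - Literature.Analysis.FluidPDE.oseenDuhamel 1 s v v t x) → (∀ t < 0, Literature.Analysis.FluidPDE.VectorCalculus.IsDivFree (v t)) → (∀ s < 0, ∀ y, 0 ≤ ⟪Literature.Analysis.FluidPDE.curl (v s) y, e3⟫_ℝ) →WindowedFluxDecay C v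

/-- Statement of the stub `stub_layerExclusion` (registered signature `StubLayerExclusion`; the research core of the
crux, XL): vortex-LAYER exclusion — a closed-hemisphere profile of the route's Type-I class whose windowed `e₃`-flux
obeys the `K/(L√(−s))` law has `⟪curl v, e₃⟫ ≡ 0` (skeleton text verbatim). -/
def StubLayerExclusion : Prop :=
  ∀ (C : ℝ) (v : ℝ → EuclideanSpace ℝ (Fin 3) → EuclideanSpace ℝ (Fin 3)), Literature.Analysis.FluidPDE.HasTypeITimeDecay C v → ContinuousOn (Function.uncurry v) (Set.Iio (0 : ℝ) ×ˢ Set.univ) → (∀ s t : ℝ, s < t → t < 0 → ∀ x, v t x = Literature.Analysis.UnboundedOperators.heatExtension (v s) (t - s) x - Literature.Analysis.FluidPDE.oseenDuhamel 1 s v v t x) → (∀ t < 0, Literature.Analysis.FluidPDE.VectorCalculus.IsDivFree (v t)) → (∀ s < 0, ∀ y, 0 ≤ ⟪Literature.Analysis.FluidPDE.curl (v s) y, e3⟫_ℝ) →WindowedFluxDecay C v → ∀ s < 0, ∀ y, ⟪Literature.Analysis.FluidPDE.curl (v s) y, e3⟫_ℝ = 0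

/-- Statement of the PLUMBING stub `stub_rotate` (registered signature `RotationCovariance`): rotation covariance —
the `e₃`-Liouville statement implies the crux `CirculationCarryingRigidity` for every direction `e ≠ 0` (skeleton
text verbatim). -/
def RotationCovariance : Prop := HemisphereLiouvilleE3 → CirculationCarryingRigidity

/-- NO EXTREMAL CLOSED-HEMISPHERE PROFILE — the re-typed research stub of line `extremal` (LEAD ns-hsw-p1 g2, crux workfile
`Cruxes/CirculationCarryingRigidity/Lines/extremal.lean`; text = the right-hand side of the tree theorem
`…ExtremalProfile.hemisphereLiouvilleE3_iff_no_extremal`, VERBATIM, so that `HemisphereLiouvilleE3 ↔ NoExtremalHemisphereProfile`):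
no closed-hemisphere profile `W` of the route's Type-I ancient Oseen-mild class (rate `C`, continuity on the open slab,
unit-viscosity Oseen–Duhamel identity, divergence-free slices, `⟪curl W, e₃⟫ ≥ 0`) attains a positive maximum `M` of the
scale-invariant `e₃`-vorticity `(−s)·⟪curl W(s)(y), e₃⟫` at the normalized point `(s, y) = (−1, 0)`. -/
def NoExtremalHemisphereProfile : Prop :=
  ∀ (C M : ℝ) (W : ℝ → EuclideanSpace ℝ (Fin 3) → EuclideanSpace ℝ (Fin 3)),
    Literature.Analysis.FluidPDE.HasTypeITimeDecay C W →
    ContinuousOn (Function.uncurry W) (Set.Iio (0 : ℝ) ×ˢ Set.univ) →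
    (∀ s t : ℝ, s < t → t < 0 → ∀ x, W t x =
      Literature.Analysis.UnboundedOperators.heatExtension (W s) (t - s) x -
        Literature.Analysis.FluidPDE.oseenDuhamel 1 s W W t x) →
    (∀ t < 0, Literature.Analysis.FluidPDE.VectorCalculus.IsDivFree (W t)) →
    (∀ s < 0, ∀ y, 0 ≤ ⟪Literature.Analysis.FluidPDE.curl (W s) y, e3⟫_ℝ) →
    0 < M → (∀ s < 0, ∀ y, (-s) * ⟪Literature.Analysis.FluidPDE.curl (W s) y, e3⟫_ℝ ≤ M) →
    ⟪Literature.Analysis.FluidPDE.curl (W (-1)) 0, e3⟫_ℝ = M → False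

open scoped Laplacian in
/-- SOURCED SWIRL TRIPLE — the hypothesis block of the non-local census tool of line `extremal` (LEAD ns-hsw-p1 g3; files
`…CirculationCarryingRigiditySourcedSwirl*`): Koch–Nadirashvili–Seregin–Šverák's swirl pair of the proof of their Thm 5.3
(tree `Literature.Analysis.FluidPDE.IsKNSSSwirlPair`: on `ℝ³ × (−∞, τ)` a scalar `f` with smooth slices, `∇f`, `Δf` jointly
continuous, axisymmetric, `f = 0` on the axis, `|f| ≤ C_f`; a jointly measurable drift `u` with smooth divergence-free slices and
`r‖u‖ ≤ C_u`) WITH AN EXTRA RADIAL DRIFT `β e_r` (jointly measurable, `|β| r ≤ A`, `|β| √(τ − t) ≤ A`, `A ≥ 0`) acting on a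
RADIALLY NON-DECREASING scalar (`Df[e_r] ≥ 0`), and the sourced swirl equation off the axis in time-integrated form
`f(t,x) − f(s,x) = ∫ₛᵗ (Δf − Df[u] − (2/r + β) ∂ᵣf)`.  (For the disc circulation `Γ = ∫_{D(r,z)} ω₃` of a closed-hemisphere
profile the circle means and the fluctuation remainder of AxisTwistDoor's circle-averaged swirl law are of the form `β ∂ᵣΓ`.) -/
structure IsSourcedSwirl (Cf Cu A τ : ℝ) (f : ℝ → EuclideanSpace ℝ (Fin 3) → ℝ)
    (u : ℝ → EuclideanSpace ℝ (Fin 3) → EuclideanSpace ℝ (Fin 3)) (β : ℝ → EuclideanSpace ℝ (Fin 3) → ℝ) : Prop where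
  /-- smooth slices. -/
  smooth : ∀ t < τ, ContDiff ℝ (⊤ : ℕ∞) (f t)
  /-- `∇f` jointly continuous on the open slab. -/
  continuousOn_fderiv : ContinuousOn (fun p : ℝ × EuclideanSpace ℝ (Fin 3) => fderiv ℝ (f p.1) p.2) (Set.Iio τ ×ˢ Set.univ)
  /-- `Δf` jointly continuous on the open slab. -/
  continuousOn_laplacian :
    ContinuousOn (fun p : ℝ × EuclideanSpace ℝ (Fin 3) => (Δ (f p.1)) p.2) (Set.Iio τ ×ˢ Set.univ)
  /-- axisymmetric slices. -/
  axisymmetric : ∀ t < τ, Literature.Analysis.FluidPDE.IsAxisymmetricScalar (f t)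
  /-- zero on the axis. -/
  axis : ∀ t < τ, ∀ x, Literature.Analysis.FluidPDE.cylRadius x = 0 → f t x = 0
  /-- bounded. -/
  abs_le : ∀ t < τ, ∀ x, |f t x| ≤ Cf
  /-- radially non-decreasing. -/
  radial_nonneg : ∀ t < τ, ∀ x, 0 ≤ fderiv ℝ (f t) x (Literature.Analysis.FluidPDE.eR x)
  /-- jointly measurable drift. -/
  measurable_drift : Measurable (Function.uncurry u)
  /-- smooth drift slices. -/
  smooth_drift : ∀ t < τ, ContDiff ℝ (⊤ : ℕ∞) (u t)
  /-- divergence-free drift slices. -/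
  divFree : ∀ t < τ, Literature.Analysis.FluidPDE.VectorCalculus.IsDivFree (u t)
  /-- `r ‖u‖ ≤ C_u`. -/
  drift_le : ∀ t < τ, ∀ x, Literature.Analysis.FluidPDE.cylRadius x * ‖u t x‖ ≤ Cu
  /-- jointly measurable extra radial drift. -/
  measurable_beta : Measurable (Function.uncurry β)
  /-- `A ≥ 0`. -/
  A_nonneg : 0 ≤ A
  /-- `|β| r ≤ A`. -/
  beta_le_radial : ∀ t < τ, ∀ x, |β t x| * Literature.Analysis.FluidPDE.cylRadius x ≤ A
  /-- `|β| √(τ − t) ≤ A`. -/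
  beta_le_time : ∀ t < τ, ∀ x, |β t x| * Real.sqrt (τ - t) ≤ A
  /-- the sourced swirl equation off the axis, integrated in time. -/
  eqn : ∀ x, Literature.Analysis.FluidPDE.cylRadius x ≠ 0 → ∀ s t : ℝ, s ≤ t → t < τ →
    f t x - f s x = ∫ r in s..t, ((Δ (f r)) x - fderiv ℝ (f r) x (u r x) -
      (2 / Literature.Analysis.FluidPDE.cylRadius x + β r x) *
        Literature.Analysis.FluidPDE.partialDeriv (Literature.Analysis.FluidPDE.eR x) (f r) x)

open scoped Laplacian in
/-- SWIRL SUBSOLUTION PAIR — the hypothesis block of the ONE-SIDED eddy-torque engine of line `eddy_torque` (LEAD ns-hsw-p1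
g4 blueprint `Lines/eddy_torque.md` §Next engine, g5 files `…CirculationCarryingRigiditySubSwirl*`): Koch–Nadirashvili–Seregin–
Šverák's swirl pair (tree `Literature.Analysis.FluidPDE.IsKNSSSwirlPair`: on `ℝ³ × (−∞, τ)` an axisymmetric scalar `f` with
smooth slices, `∇f`, `Δf` jointly continuous, `f = 0` on the axis, `|f| ≤ C_f`; a drift `u` with smooth divergence-free slices and
`r‖u‖ ≤ C_u`), RADIALLY NON-DECREASING (`Df[e_r] ≥ 0`), which instead of the swirl equation satisfies, off the axis and
pointwise in time, the two DIFFERENTIAL INEQUALITIES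
`∂ₜf ≤ Δf − Df[u] − (2/r)∂ᵣf + (A/r)∂ᵣf` and `∂ₜf ≤ Δf − Df[u] − (2/r)∂ᵣf + (A/√(τ−t))∂ᵣf` (`A ≥ 0`)
— i.e. `f` is a SUBSOLUTION of the sourced swirl equation of `IsSourcedSwirl` whose source is slaved ONE-SIDEDLY to `∂ᵣf` —
together with the regularity that replaces KNSS's Lemma 2.1 (a statement about solutions) by positivity propagation for the
supersolution `M − f`: `f` and `u` jointly smooth on the open slab, and the scale-invariant gradient bound
`‖∇f(t,x)‖ ≤ C_g (1/√(τ−t) + r/(τ−t))`.  (For the disc circulation `F = (2π)⁻¹Γ` of a closed-hemisphere axis-Type-I profile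
with the angular-mean drift `⟨v⟩_θ`, the one-sided eddy-torque bound `ℛ ≤ A/(r+√(−s))·∮ω₃ dl` gives exactly this, by the
tree's `…EddyTorqueOneSided.circF_subsolution_of_oneSided` and the class rates.) -/
structure IsSubSwirl (Cf Cu Cg A τ : ℝ) (f : ℝ → EuclideanSpace ℝ (Fin 3) → ℝ)
    (u : ℝ → EuclideanSpace ℝ (Fin 3) → EuclideanSpace ℝ (Fin 3)) : Prop where
  /-- smooth slices. -/
  smooth : ∀ t < τ, ContDiff ℝ (⊤ : ℕ∞) (f t)
  /-- jointly smooth on the open slab (`IsSmoothSpaceTimeOn (Iio τ) f`, unfolded). -/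
  smooth_joint : ContDiffOn ℝ (⊤ : ℕ∞) (Function.uncurry f) (Set.Iio τ ×ˢ Set.univ)
  /-- `∇f` jointly continuous on the open slab. -/
  continuousOn_fderiv : ContinuousOn (fun p : ℝ × EuclideanSpace ℝ (Fin 3) => fderiv ℝ (f p.1) p.2) (Set.Iio τ ×ˢ Set.univ)
  /-- `Δf` jointly continuous on the open slab. -/
  continuousOn_laplacian :
    ContinuousOn (fun p : ℝ × EuclideanSpace ℝ (Fin 3) => (Δ (f p.1)) p.2) (Set.Iio τ ×ˢ Set.univ)
  /-- axisymmetric slices. -/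
  axisymmetric : ∀ t < τ, Literature.Analysis.FluidPDE.IsAxisymmetricScalar (f t)
  /-- zero on the axis. -/
  axis : ∀ t < τ, ∀ x, Literature.Analysis.FluidPDE.cylRadius x = 0 → f t x = 0
  /-- bounded. -/
  abs_le : ∀ t < τ, ∀ x, |f t x| ≤ Cf
  /-- radially non-decreasing. -/
  radial_nonneg : ∀ t < τ, ∀ x, 0 ≤ fderiv ℝ (f t) x (Literature.Analysis.FluidPDE.eR x)
  /-- scale-invariant gradient bound `‖∇f(t,x)‖ ≤ C_g (1/√(τ−t) + r/(τ−t))`. -/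
  grad_le : ∀ t < τ, ∀ x, ‖fderiv ℝ (f t) x‖ ≤
    Cg * (1 / Real.sqrt (τ - t) + Literature.Analysis.FluidPDE.cylRadius x / (τ - t))
  /-- jointly measurable drift. -/
  measurable_drift : Measurable (Function.uncurry u)
  /-- smooth drift slices. -/
  smooth_drift : ∀ t < τ, ContDiff ℝ (⊤ : ℕ∞) (u t)
  /-- jointly smooth drift on the open slab (`IsSmoothSpaceTimeOn (Iio τ) u`, unfolded). -/
  smooth_drift_joint : ContDiffOn ℝ (⊤ : ℕ∞) (Function.uncurry u) (Set.Iio τ ×ˢ Set.univ)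
  /-- divergence-free drift slices. -/
  divFree : ∀ t < τ, Literature.Analysis.FluidPDE.VectorCalculus.IsDivFree (u t)
  /-- `r ‖u‖ ≤ C_u`. -/
  drift_le : ∀ t < τ, ∀ x, Literature.Analysis.FluidPDE.cylRadius x * ‖u t x‖ ≤ Cu
  /-- `A ≥ 0`. -/
  A_nonneg : 0 ≤ A
  /-- the swirl SUB-equation with the RADIAL form of the one-sided source, off the axis, pointwise in time:
  `∂ₜf ≤ Δf − Df[u] − (2/r)∂ᵣf + (A/r)∂ᵣf`. -/
  sub_radial : ∀ t < τ, ∀ x, Literature.Analysis.FluidPDE.cylRadius x ≠ 0 →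
    deriv (fun σ => f σ x) t ≤ (Δ (f t)) x - fderiv ℝ (f t) x (u t x) -
      2 / Literature.Analysis.FluidPDE.cylRadius x *
        Literature.Analysis.FluidPDE.partialDeriv (Literature.Analysis.FluidPDE.eR x) (f t) x +
      A / Literature.Analysis.FluidPDE.cylRadius x *
        Literature.Analysis.FluidPDE.partialDeriv (Literature.Analysis.FluidPDE.eR x) (f t) x
  /-- the swirl SUB-equation with the TIME form of the one-sided source, off the axis, pointwise in time:
  `∂ₜf ≤ Δf − Df[u] − (2/r)∂ᵣf + (A/√(τ−t))∂ᵣf`. -/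
  sub_time : ∀ t < τ, ∀ x, Literature.Analysis.FluidPDE.cylRadius x ≠ 0 →
    deriv (fun σ => f σ x) t ≤ (Δ (f t)) x - fderiv ℝ (f t) x (u t x) -
      2 / Literature.Analysis.FluidPDE.cylRadius x *
        Literature.Analysis.FluidPDE.partialDeriv (Literature.Analysis.FluidPDE.eR x) (f t) x +
      A / Real.sqrt (τ - t) *
        Literature.Analysis.FluidPDE.partialDeriv (Literature.Analysis.FluidPDE.eR x) (f t) x

/-! ### Line «gauss-swirl» (ideator ns-idea-4 g11, D-0145 files-only line; file of record `GaussSwirl_v1_4.lean`, sha16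
9f36760ac8cb3b0a, kernel-checked rc 0 with the single sorry K1; ported into the tree by the LEAD ns-hsw-p1 g6, texts VERBATIM modulo
the `E3 ↦ EuclideanSpace ℝ (Fin 3)` spelling and fully qualified names): the GAUSSIAN AXIAL ANGULAR MOMENTUM vocabulary and the
obligation / stratum statements.  The proofs live in `Theorems/HalfSpaceWindowDoorCirculationCarryingRigidityGauss*.lean`
(`…GaussKernel`, `…GaussCirculation`, `…GaussStein`, `…GaussTilting`, `…GaussVorticityLaw`, `…GaussSwirlLaw`, `…GaussRepresentation`):
O1–O3, R, R⁺, R′ are PROVED there; K1 `PersistentAxis` is the declared wall-strength residual (`PersistentAxis ↔ HemisphereLiouvilleE3`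
is proved in `…GaussRepresentation`) — it is NOT a registered stub and nothing is closed by it.  Dictionary (2D one-signed vorticity,
Poincaré's moment law `d/dt∫|x|²ω = 4νΦ` ↦ 3D closed hemisphere): `ω ↦ ω₃`, `∫|x|²ω ↦` Gaussian axial angular momentum `𝒢`,
«Lamb-vector torque integrates to 0» ↦ «pressure and vortex tilting drop out exactly against the divergence-free Gaussian swirl field
`K_t(x−x₀)·e₃×(x−x₀)`», `dI/dt = 4νΦ ↦ d𝒢/ds = −𝒢/(s₀−s) − ℐ/(2(s₀−s))`, «`I ≥ 0` ancient ⇒ `Φ = 0`» ↦ the far-past ODE lemma. -/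

/-- The route's Type-I ancient Oseen-mild class (TIME-ONLY rate `‖v(t,·)‖ ≤ C/√(−t)`): the four structural hypotheses of
`HemisphereLiouvilleE3`, bundled (line «gauss-swirl», text verbatim). -/
def InDoorClass (C : ℝ) (v : ℝ → EuclideanSpace ℝ (Fin 3) → EuclideanSpace ℝ (Fin 3)) : Prop :=
  Literature.Analysis.FluidPDE.HasTypeITimeDecay C v ∧
  ContinuousOn (Function.uncurry v) (Set.Iio (0 : ℝ) ×ˢ Set.univ) ∧
  (∀ s t : ℝ, s < t → t < 0 → ∀ x, v t x = Literature.Analysis.UnboundedOperators.heatExtension (v s) (t - s) x -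
    Literature.Analysis.FluidPDE.oseenDuhamel 1 s v v t x) ∧
  (∀ t < 0, Literature.Analysis.FluidPDE.VectorCalculus.IsDivFree (v t))

/-- Closed hemisphere along `e₃`: `⟪curl v(s), e₃⟫ ≥ 0` on the open lower slab (the sign hypothesis of `HemisphereLiouvilleE3`,
bundled; line «gauss-swirl», text verbatim). -/
def SignE3 (v : ℝ → EuclideanSpace ℝ (Fin 3) → EuclideanSpace ℝ (Fin 3)) : Prop :=
  ∀ s < 0, ∀ y, 0 ≤ ⟪Literature.Analysis.FluidPDE.curl (v s) y, e3⟫_ℝ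

/-- The (unnormalised) Gaussian of variance `2t` centred at `x₀`: `gauss t x₀ x = e^{−‖x − x₀‖²/(4t)}` (line «gauss-swirl»). -/
def gauss (t : ℝ) (x₀ x : EuclideanSpace ℝ (Fin 3)) : ℝ := Real.exp (-(‖x - x₀‖ ^ 2) / (4 * t))

/-- Axial angular-momentum density about the vertical axis through `x₀`: `g = (x−x₀)₀ u₁ − (x−x₀)₁ u₀` (line «gauss-swirl»). -/
def angMom (x₀ : EuclideanSpace ℝ (Fin 3)) (u : EuclideanSpace ℝ (Fin 3) → EuclideanSpace ℝ (Fin 3))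
    (x : EuclideanSpace ℝ (Fin 3)) : ℝ :=
  (x - x₀) 0 * u x 1 - (x - x₀) 1 * u x 0

/-- GAUSSIAN AXIAL ANGULAR MOMENTUM `𝒢(t; x₀)[u] = t^{−3/2} ∫ e^{−‖x−x₀‖²/4t} g dx` (line «gauss-swirl», dictionary row 2; junk
value for `t ≤ 0` through `Real.rpow`, never used there). -/
def gaussAngMom (t : ℝ) (x₀ : EuclideanSpace ℝ (Fin 3)) (u : EuclideanSpace ℝ (Fin 3) → EuclideanSpace ℝ (Fin 3)) : ℝ :=
  t ^ (-(3 : ℝ) / 2) * ∫ x, gauss t x₀ x * angMom x₀ u x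

/-- GAUSSIAN INFLOW CORRELATION `ℐ(t; x₀)[u] = t^{−3/2} ∫ e^{−‖x−x₀‖²/4t} ⟪x − x₀, u⟫ g dx` (line «gauss-swirl», dictionary row 4;
`ℐ < 0` = net Gaussian-mean INFLOW of positive axial angular momentum about the axis through `x₀`). -/
def gaussInflow (t : ℝ) (x₀ : EuclideanSpace ℝ (Fin 3)) (u : EuclideanSpace ℝ (Fin 3) → EuclideanSpace ℝ (Fin 3)) : ℝ :=
  t ^ (-(3 : ℝ) / 2) * ∫ x, gauss t x₀ x * (⟪x - x₀, u x⟫_ℝ * angMom x₀ u x)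

/-- **O1 (M–L) Gaussian swirl law** (line «gauss-swirl»; PROVED in `…GaussSwirlLaw.gaussianSwirlLaw_holds`).  Along every parabolic
characteristic `t = s₀ − s` the Gaussian angular momentum of a door-class profile obeys `d/ds 𝒢 = −𝒢/(s₀−s) − ℐ/(2(s₀−s))` —
Navier–Stokes tested against the divergence-free Gaussian swirl field `ζ = K_{s₀−s}(x−x₀)·e₃×(x−x₀)`; pressure and vortex tilting
drop out exactly. -/
def GaussianSwirlLaw : Prop :=
  ∀ (C : ℝ) (v : ℝ → EuclideanSpace ℝ (Fin 3) → EuclideanSpace ℝ (Fin 3)), InDoorClass C v →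
    ∀ (x₀ : EuclideanSpace ℝ (Fin 3)) (s₀ s : ℝ), s < 0 → s < s₀ →
    HasDerivAt (fun σ => gaussAngMom (s₀ - σ) x₀ (v σ))
      (-(gaussAngMom (s₀ - s) x₀ (v s)) / (s₀ - s) - gaussInflow (s₀ - s) x₀ (v s) / (2 * (s₀ - s))) s

/-- **O2 (S–M) Gaussian Kelvin–Stokes** (line «gauss-swirl»; PROVED in `…GaussCirculation.gaussianCirculation_holds`).  For a
closed-hemisphere door-class profile, `𝒢(t;x₀)[v(s)] = 2t^{−1/2}∫e^{−‖x−x₀‖²/4t}ω₃ ≥ 0`, and `𝒢 = 0` forces `ω₃(s,·) ≡ 0`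
(Gaussian positive, `ω₃` continuous non-negative). -/
def GaussianCirculation : Prop :=
  ∀ (C : ℝ) (v : ℝ → EuclideanSpace ℝ (Fin 3) → EuclideanSpace ℝ (Fin 3)), InDoorClass C v → SignE3 v →
    ∀ (x₀ : EuclideanSpace ℝ (Fin 3)) (t s : ℝ), 0 < t → s < 0 →
    0 ≤ gaussAngMom t x₀ (v s) ∧ (gaussAngMom t x₀ (v s) = 0 → ∀ y, ⟪Literature.Analysis.FluidPDE.curl (v s) y, e3⟫_ℝ = 0)

/-- **O3 (S) Far-past boundedness** of `𝒢` along a characteristic (line «gauss-swirl»; PROVED in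
`…GaussCirculation.gaussianBound_holds`): from the Type-I rate and the Gaussian first moment,
`|𝒢(s₀−s; x₀)[v(s)]| ≤ 32π·C·√((s₀−s)/(−s))`, bounded on every ray `s < s₂ < min(0,s₀)`. -/
def GaussianBound : Prop :=
  ∀ (C : ℝ) (v : ℝ → EuclideanSpace ℝ (Fin 3) → EuclideanSpace ℝ (Fin 3)), InDoorClass C v →
    ∀ (x₀ : EuclideanSpace ℝ (Fin 3)) (s₀ : ℝ),
    ∃ B s₂ : ℝ, s₂ < 0 ∧ s₂ < s₀ ∧ ∀ s < s₂, |gaussAngMom (s₀ - s) x₀ (v s)| ≤ B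

/-- **K1 (XL, RESEARCH — wall-strength, declared; NOT a registered stub) Persistent non-inflow axis** (line «gauss-swirl»).  Every
closed-hemisphere door-class profile admits ONE space–time axis `(x₀, s₀)` and an epoch `s₁` before which the Gaussian inflow
correlation is `≥ 0`.  It is EXACTLY the wall read through `ℐ`: `PersistentAxis ↔ HemisphereLiouvilleE3`
(`…GaussRepresentation.persistentAxis_iff_hemisphereLiouvilleE3`).  Why it might fail: a non-poloidal closed-hemisphere profile must draw
angular momentum inward about EVERY axis at some far-past epochs (Burgers-type columns do; none is in the class). -/
def PersistentAxis : Prop :=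
  ∀ (C : ℝ) (v : ℝ → EuclideanSpace ℝ (Fin 3) → EuclideanSpace ℝ (Fin 3)), InDoorClass C v → SignE3 v →
    ∃ (x₀ : EuclideanSpace ℝ (Fin 3)) (s₀ s₁ : ℝ), s₁ < 0 ∧ s₁ < s₀ ∧ ∀ s < s₁, 0 ≤ gaussInflow (s₀ - s) x₀ (v s)

/-- **R (the RUNG) — stratum of NO GAUSSIAN-MEAN INFLOW about one space–time axis** (line «gauss-swirl»; PROVED in
`…GaussSwirlLaw.noInflowStratum_holds`).  In the TIME-ONLY class: closed-hemisphere door-class profiles with no Gaussian-mean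
angular-momentum inflow about ONE space–time axis before some epoch are poloidal. -/
def NoInflowStratum : Prop :=
  ∀ (C : ℝ) (v : ℝ → EuclideanSpace ℝ (Fin 3) → EuclideanSpace ℝ (Fin 3)), InDoorClass C v → SignE3 v →
    ∀ (x₀ : EuclideanSpace ℝ (Fin 3)) (s₀ s₁ : ℝ), s₁ < 0 → s₁ < s₀ →
    (∀ s < s₁, 0 ≤ gaussInflow (s₀ - s) x₀ (v s)) → ∀ s < 0, ∀ y, ⟪Literature.Analysis.FluidPDE.curl (v s) y, e3⟫_ℝ = 0

/-- **O1a (DYNAMIC) Gaussian vorticity law** (line «gauss-swirl»; PROVED in `…GaussSwirlLaw.gaussianVorticityLaw_holds`).  On the door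
class (no sign hypothesis), for every axis datum and `s < min(0,s₀)`:
`d/ds ∫ G_{s₀−s}(x−x₀) ⟪curl v(s), e₃⟫ dx = ∫ ∂₀G F₀ + ∫ ∂₁G F₁`, `Fⱼ = vⱼω₃ − ωⱼv₃`, `G` the 3D heat kernel. -/
def GaussianVorticityLaw : Prop :=
  ∀ (C : ℝ) (v : ℝ → EuclideanSpace ℝ (Fin 3) → EuclideanSpace ℝ (Fin 3)), InDoorClass C v →
    ∀ (x₀ : EuclideanSpace ℝ (Fin 3)) (s₀ s : ℝ), s < 0 → s < s₀ →
    HasDerivAt (fun σ => ∫ x, Literature.Analysis.UnboundedOperators.heatKernel (s₀ - σ) (x - x₀) *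
        ⟪Literature.Analysis.FluidPDE.curl (v σ) x, e3⟫_ℝ)
      ((∫ x, fderiv ℝ (fun y : EuclideanSpace ℝ (Fin 3) =>
              Literature.Analysis.UnboundedOperators.heatKernel (s₀ - s) (y - x₀)) x (EuclideanSpace.single 0 1) *
            (v s x 0 * Literature.Analysis.FluidPDE.curl (v s) x 2 - Literature.Analysis.FluidPDE.curl (v s) x 0 * v s x 2)) +
        ∫ x, fderiv ℝ (fun y : EuclideanSpace ℝ (Fin 3) =>
              Literature.Analysis.UnboundedOperators.heatKernel (s₀ - s) (y - x₀)) x (EuclideanSpace.single 1 1) *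
            (v s x 1 * Literature.Analysis.FluidPDE.curl (v s) x 2 - Literature.Analysis.FluidPDE.curl (v s) x 1 * v s x 2)) s

/-- **O1b (KINEMATIC) Gaussian inflow identity** (line «gauss-swirl»; PROVED in `…GaussSwirlLaw.gaussianInflowIdentity_holds`).  On the
door class, for `t > 0`, `s < 0`: `ℐ(t;x₀)[v(s)] = (4π)^{3/2}·2t·∫ G_t(x−x₀)[(x−x₀)₀F₀ + (x−x₀)₁F₁] dx` (Stein's identity along a
divergence-free field + the swirl algebra `(v·∇)v = ∇|v|²/2 − v×ω`; the Bernoulli term pairs to zero against the radial Gaussian). -/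
def GaussianInflowIdentity : Prop :=
  ∀ (C : ℝ) (v : ℝ → EuclideanSpace ℝ (Fin 3) → EuclideanSpace ℝ (Fin 3)), InDoorClass C v →
    ∀ (x₀ : EuclideanSpace ℝ (Fin 3)) (t s : ℝ), 0 < t → s < 0 →
    gaussInflow t x₀ (v s) = (4 * Real.pi) ^ ((3 : ℝ) / 2) * (2 * t) *
      ∫ x, Literature.Analysis.UnboundedOperators.heatKernel t (x - x₀) *
        ((x - x₀) 0 * (v s x 0 * Literature.Analysis.FluidPDE.curl (v s) x 2 - Literature.Analysis.FluidPDE.curl (v s) x 0 * v s x 2) +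
          (x - x₀) 1 * (v s x 1 * Literature.Analysis.FluidPDE.curl (v s) x 2 - Literature.Analysis.FluidPDE.curl (v s) x 1 * v s x 2))

/-- **Stratum R⁺ — ACCUMULATED-INFLOW stratum** (line «gauss-swirl» v1.3; PROVED in `…GaussRepresentation.accumulatedInflowStratum_holds`;
contains R).  Closed hemisphere + one space–time axis about which the accumulated weighted Gaussian inflow
`∫_{(−∞,s]} ℐ(σ)(s₀−σ)^{−2}dσ` is `≥ 0` at every epoch `s < s₁` ⇒ poloidal. -/
def AccumulatedInflowStratum : Prop :=
  ∀ (C : ℝ) (v : ℝ → EuclideanSpace ℝ (Fin 3) → EuclideanSpace ℝ (Fin 3)), InDoorClass C v → SignE3 v →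
    ∀ (x₀ : EuclideanSpace ℝ (Fin 3)) (s₀ s₁ : ℝ), s₁ < 0 → s₁ < s₀ →
    (∀ s < s₁, 0 ≤ ∫ σ in Set.Iic s, gaussInflow (s₀ - σ) x₀ (v σ) / (s₀ - σ) ^ 2) →
    ∀ s < 0, ∀ y, ⟪Literature.Analysis.FluidPDE.curl (v s) y, e3⟫_ℝ = 0

/-- **Stratum R′ — CO-SIGNED stratum** (line «gauss-swirl» v1.3; PROVED in `…GaussRepresentation.coSignedStratum_holds`; pointwise, no
Gaussian in the hypothesis).  Closed hemisphere + one space–time axis `(x₀, s₀)` about which, at all times before some epoch, the 3-D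
radial velocity `⟪x − x₀, v⟫` and the axial angular-momentum density `g = (x−x₀)₀v₁ − (x−x₀)₁v₀` are everywhere co-signed
(`⟪x − x₀, v⟫·g ≥ 0`: no inflow where the swirl is positive) ⇒ poloidal. -/
def CoSignedStratum : Prop :=
  ∀ (C : ℝ) (v : ℝ → EuclideanSpace ℝ (Fin 3) → EuclideanSpace ℝ (Fin 3)), InDoorClass C v → SignE3 v →
    ∀ (x₀ : EuclideanSpace ℝ (Fin 3)) (s₀ s₁ : ℝ), s₁ < 0 → s₁ < s₀ →
    (∀ s < s₁, ∀ x, 0 ≤ ⟪x - x₀, v s x⟫_ℝ * angMom x₀ (v s) x) →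
    ∀ s < 0, ∀ y, ⟪Literature.Analysis.FluidPDE.curl (v s) y, e3⟫_ℝ = 0

end Summit.NavierStokesRegularity.NavierStokesRegularity.Theorems.HalfSpaceWindowDoorCirculationCarryingRigidityDefs

end
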